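import Literature.NumberTheory.Rogawski1990.ArchBouazizSmoothBoundedOfMultiWallInv     -- ★ p851270 (this seat): `archBzSmoothBounded_stOrbFamH_of_multiWallInv` (the (α4) assembly modulo the engine)
import Literature.NumberTheory.Automorphic.ArchMultiWallCasimir                       -- ★ p851269 (LH10-p01 (g4)): (α4-S6) `RankOneCasimir.multiWall_inv` = the `k`-fold Casimir engine (frozen text v4)
import Literature.NumberTheory.Rogawski1990.ArchBouazizStableFamilyWeyl                  -- ★ p849865 (LH3-p01 (g3)): `archBouazizSpaceH_stOrbFamH_of_smoothBounded_of_jump` ((P)(W)(I₄) discharged)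
import HarnessLib

/-!
# BOUAZIZ (I₁)+(I₂) FOR THE STABLE ORBITAL FAMILY OF EVERY TEST FUNCTION ON `H_∞ = ∏_w U(Φ₂) × U(Φ₁)` — UNCONDITIONAL (organ O-L3′ conjunct (ii), general `fH`; Bouaziz 1994 §3.1, Shelstad 1979 §4)

Topic `NumberTheory/Rogawski1990`; namespace `Literature.NumberTheory.Rogawski1990`.  THEOREMS ONLY (no `def`, no instance, no axiom, no `sorry`).  Cell `pub/hodgecm-mathlib`,
crux H413 (`stmt-HodgeConjecture-24833`), line LH3 (closer stub `stub_N9`, DIRECT ROAD), letter L3′ `stub_N9bouazizSurjective`, forward half.  Author LH3-p01 (g5) ((α4) spec owner).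
Count-neutral.

THE RESULT.  **`archBzSmoothBounded_stOrbFamH (hfH : ArchSmooth₂ L fH) : ArchBzSmoothBounded (stOrbFamH L νH fH)`** — for EVERY `fH ∈ C_c^∞(H_∞)` and every Haar measure `νH`, the normalised
stable orbital family is `C^∞` on `InRegS S` with all its jets bounded on `K ∩ InRegS S` (every chart `S`, every compact `K`): ★ `archBzSmoothBounded_stOrbFamH_of_multiWallInv` (the
(α4) «all-orders transport», stages S2–S7, ★ p850963 … p851270) with its single hypothesis `hInv` DISCHARGED by ★ `RankOneCasimir.multiWall_inv` (LH10-p01 (g4)'s `k`-fold Casimir engine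
(α4-S6), frozen text v4, read at `ι := ↥P₀`, `wl := Subtype.val`, centre `1`).  This closes conjunct (ii) of organ O-L3′ for GENERAL `fH` (v2's `hJ : ArchSmoothDefinite` restriction is gone).
COROLLARY **`archBouazizSpaceH_stOrbFamH_of_jump`**: with (P), (W), (I₄) already ★ and (I₁)+(I₂) now ★, membership of `stOrbFamH L νH fH` in Bouaziz's space `ArchBouazizSpaceH jcH` reduces to
the single jump clause (J) `ArchBzJump jcH (stOrbFamH L νH fH)` — the residue of record of the forward half of letter L3′.
HONEST LABEL: HC_CM is proved only modulo the 7 printed citations (2 remaining: hLiu418 = stmt-HodgeConjecture-24832, h413 = stmt-HodgeConjecture-24833) until rung 0 closes; letter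
L3′ itself (`∃ jcH ≠ 0`, forward AND surjective halves) is NOT claimed here.

## References
* [Bouaziz1994IntegralesOrbitales] A. Bouaziz, *Intégrales orbitales sur les algèbres de Lie réductives*, Invent. Math. 115 (1994), §3.1 (I₁)(I₂) p. 579; §3.2 p. 580; §6.2 p. 591.
* [Shelstad1979] D. Shelstad, *Characters and inner forms of a quasi-split group over ℝ*, Compositio Math. 39 (1979), §4 pp. 22–25.
* [Varadarajan1989] V. S. Varadarajan, *An Introduction to Harmonic Analysis on Semisimple Lie Groups*, Cambridge Stud. Adv. Math. 16 (1989), §6.4 Thms 22–24.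
-/

set_option autoImplicit false

noncomputable section

open MeasureTheory Measure Filter Topology Set Function NumberField NumberField.InfinitePlace NumberField.mixedEmbedding Matrix Complex
open Literature.NumberTheory.Automorphic Literature.NumberTheory.Automorphic.UnitaryGroup Literature.NumberTheory.Automorphic.ArchCartan
open scoped ContDiff MatrixGroups Matrix Classical ENNReal NNReal
open scoped Matrix.Norms.Operator

namespace Literature.NumberTheory.Rogawski1990

local notation3 "Φ₂[" L "]" => (Matrix.of fun i j : Fin 2 => if i.val + j.val + 1 = 2 then (1 : L) else 0)
local notation3 "Φ₁[" L "]" => (Matrix.of fun i j : Fin 1 => if i.val + j.val + 1 = 1 then (1 : L) else 0)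
local notation3 "𝔸[" L "]" => ↥(arch (↥(maximalRealSubfield L)) L (IsCMField.complexConj L) 2 Φ₂[L])
local notation3 "𝔹[" L "]" => ↥(arch (↥(maximalRealSubfield L)) L (IsCMField.complexConj L) 1 Φ₁[L])

variable (L : Type) [Field L] [NumberField L] [IsCMField L]
  [∀ w : {w : InfinitePlace L // IsComplex w}, MeasurableSpace ↥(archLocal L 2 Φ₂[L] w)]
  [∀ w : {w : InfinitePlace L // IsComplex w}, BorelSpace ↥(archLocal L 2 Φ₂[L] w)]
  [MeasurableSpace 𝔸[L]] [BorelSpace 𝔸[L]] [MeasurableSpace 𝔹[L]] [BorelSpace 𝔹[L]]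
  (νH : Measure (𝔸[L] × 𝔹[L])) [νH.IsHaarMeasure] [νH.IsMulRightInvariant]

/-- **BOUAZIZ (I₁)+(I₂) FOR THE STABLE ORBITAL FAMILY OF EVERY TEST FUNCTION — UNCONDITIONAL**: for `fH ∈ C_c^∞(H_∞)` (★ `ArchSmooth₂`) and `νH` Haar, `ArchBzSmoothBounded (stOrbFamH L νH fH)`:
every chart family is `C^∞` on `InRegS S` and all its jets are bounded on `K ∩ InRegS S` for every compact `K` (★ the (α4) assembly + ★ the `k`-fold Casimir engine `multiWall_inv`).
[cite: Bouaziz1994IntegralesOrbitales, §3.1 (I₁)(I₂) p. 579; §6.2 p. 591] [cite: Shelstad1979, §4 pp. 22–25] [cite: Varadarajan1989, §6.4 Thms 22–24] -/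
theorem archBzSmoothBounded_stOrbFamH {fH : 𝔸[L] × 𝔹[L] → ℂ} (hfH : ArchSmooth₂ L fH) : ArchBzSmoothBounded (stOrbFamH L νH fH) :=
  archBzSmoothBounded_stOrbFamH_of_multiWallInv L νH hfH fun P₀ ν _ _ => by
    simpa only using RankOneCasimir.multiWall_inv L (↥P₀) (fun i : ↥P₀ => i.1) (fun _ => (1 : Circle)) ν

/-- **MEMBERSHIP IN BOUAZIZ'S SPACE REDUCES TO THE JUMP CLAUSE**: for `fH ∈ C_c^∞(H_∞)`, `νH` Haar and any jump datum `jcH`, (P), (W), (I₁)+(I₂), (I₄) hold for `stOrbFamH L νH fH`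
(★ `archBzPeriodic_stOrbFamH`, ★ `archBzWeyl_stOrbFamH_of_isHaarMeasure`, `archBzSmoothBounded_stOrbFamH`, ★ `archBzCompactSupport_stOrbFamH`), so
`ArchBzJump jcH (stOrbFamH L νH fH) → ArchBouazizSpaceH jcH (stOrbFamH L νH fH)` — the forward half of letter L3′ is the jump clause (J) alone.
[cite: Bouaziz1994IntegralesOrbitales, §3.2 p. 580; §6.2 p. 591] [cite: Shelstad1979, §4 pp. 22–25] -/
theorem archBouazizSpaceH_stOrbFamH_of_jump (jcH : Finset {w : InfinitePlace L // IsComplex w} → {w : InfinitePlace L // IsComplex w} → ℂ) {fH : 𝔸[L] × 𝔹[L] → ℂ}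
    (hfH : ArchSmooth₂ L fH) (hJ : ArchBzJump jcH (stOrbFamH L νH fH)) : ArchBouazizSpaceH jcH (stOrbFamH L νH fH) :=
  archBouazizSpaceH_stOrbFamH_of_smoothBounded_of_jump L νH jcH fH (ArchSmooth₂.hasCompactSupport L hfH) (archBzSmoothBounded_stOrbFamH L νH hfH) hJ

end Literature.NumberTheory.Rogawski1990

end
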